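import Literature.Topology.FourManifolds.InvertedPicture
import Literature.Topology.FourManifolds.LongAnnulusShear
import Literature.Topology.FourManifolds.BandSumModel
import HarnessLib

/-!
# The inverted pictures of a flat-strip long annulus as model data for the band sum

Topic `Literature/Topology/FourManifolds`; step V5-3 of the proof programme of the Fox–Milnor fact
`Literature.Topology.FourManifolds.Knot.exists_isConnectedSum_isConcordant`. Everything here is
proved; no named fact is introduced.

Input: a long annulus `D : LongAnnulus η` (`LongAnnulusShear.lean`) with a **flat strip**
(`StripPicture`): a point `x₀`, a horizontal unit direction `e`, a parameter `θ₁`, a half-width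
`δ₁` and a radius `r'` such that `D.F (θ, s) = (x₀ + (2π(θ - θ₁ - m)) • e, s)` whenever
`|θ - θ₁ - m| < δ₁` (`m ∈ ℤ`), while every other position is at distance `≥ r'` from `x₀` (this
is the output of `LongAnnulus.exists_flat_strip`). With the ring diameter `a = r'/8` and the
cut-off `cutoff a` (`= 1` on `|w| ≤ a/16`, `= 0` off `(-a/8, a/8)`) the map `Ψ` of
`InvertedPicture.lean` turns the end curves `D.k₁`, `D.k₂` into chart loops `Ψ ∘ D.kᵢ`
(`StripPicture.isChartLoop_Ψk₁/₂`) whose knots `Kn₁`, `Kn₂` are isotopic to the knots of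
`D.k₁`, `D.k₂` and have the **flat-arc normal form** required by `BandFoliation.ModelData`
(`BandSumModel.lean`): lowest flat segment `x₀ + s e`, `|s| ≤ ℓ = W a (a/16)`, traversed as
`x₀ + W a (θ - 2πθ₁) • e`, a clean box of height `a/4`, and the bound `‖·‖ ≤ ‖x₀‖ + 2a`
(`lowest`, `box`, `seg₁`/`seg₂`, `norm_Ψ_le`, valid at every level of the annulus). Finally
`modelData₁` packages the lower knot with given sizes `am, l, δ` and frame sign, and the upper
knot is presented as a **second knot piece over the same chart and segment data**
(`piece₂ : KnotPiece md.chart md.seg'`, with its tube fit `tubeFit₂` and cleanness `clean₂`),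
so that both ends of the later surface detour live in one band chart.

## References

* R. H. Fox, J. W. Milnor, Osaka J. Math. 3 (1966), §1. [FoxMilnor1966]

## Design notes

No named facts, no `sorry`; `𝔼 n`, `𝕊 n` are local notation as in `Knots.lean`.
-/

open scoped Manifold Topology ContDiff Real RealInnerProductSpace
open Function Set Metric Filter

noncomputable section

namespace Literature.Topology.FourManifolds

/-- Local notation: `𝔼 n` is the model Euclidean space `EuclideanSpace ℝ (Fin n)`. -/
local notation "𝔼 " n:arg => EuclideanSpace ℝ (Fin n)

/-- Local notation: `𝕊 n` is the unit sphere in `EuclideanSpace ℝ (Fin (n + 1))`. -/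
local notation "𝕊 " n:arg => (Metric.sphere (0 : EuclideanSpace ℝ (Fin (n + 1))) 1)

attribute [local instance] fact_finrank_euclideanSpace_succ

open KnotsInBall FoxMilnorModel InvertedPicture BandFoliation

/-! ### The end curves of a long annulus are chart loops -/

namespace LongAnnulus

variable {η : ℝ} (A : LongAnnulus η)

/-- The partial derivative in `θ` of the annulus on the lower collar is `(k₁', 0)`. [folklore] -/
theorem hasDerivAt_F_one (θ : ℝ) : HasDerivAt (fun t ↦ A.F (t, 1)) (deriv A.k₁ θ, 0) θ := by
  have hfun : (fun t ↦ A.F (t, 1)) = fun t ↦ (A.k₁ t, (1 : ℝ)) := funext fun t ↦ A.collar₁ t 1 (by linarith [A.η_pos])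
  rw [hfun]
  exact ((A.contDiff_k₁.differentiable (by simp)) θ).hasDerivAt.prodMk (hasDerivAt_const θ (1 : ℝ))

/-- **The lower end curve of a long annulus is a chart loop.** [folklore] -/
theorem isChartLoop_k₁ : IsChartLoop A.k₁ where
  contDiff := A.contDiff_k₁
  periodic θ := by rw [A.k₁_eq, A.k₁_eq, A.F_add_one]
  deriv_ne_zero θ h0 := by
    have hinj := A.injective_fderiv (θ, 1) ⟨le_rfl, by norm_num⟩
    have hF : DifferentiableAt ℝ A.F (θ, 1) := (A.contDiff_F.differentiable (by simp)) _
    -- the derivative along `(1, 0)` is `(k₁' θ, 0) = 0`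
    have hline : HasDerivAt (fun t : ℝ ↦ ((t, (1 : ℝ)) : ℝ × ℝ)) ((1 : ℝ), (0 : ℝ)) θ :=
      (hasDerivAt_id θ).prodMk (hasDerivAt_const θ (1 : ℝ))
    have hcomp := hF.hasFDerivAt.comp_hasDerivAt θ hline
    have h1 := hcomp.unique (A.hasDerivAt_F_one θ)
    rw [h0] at h1
    have h2 : fderiv ℝ A.F (θ, 1) ((1 : ℝ), (0 : ℝ)) = 0 := by rw [h1]; rfl
    have := hinj (h2.trans (map_zero _).symm)
    simp at this
  inj s t hst := by
    have h := A.inj (s, 1) (t, 1) ⟨le_rfl, by norm_num⟩ ⟨le_rfl, by norm_num⟩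
      (by rw [A.collar₁ s 1 (by linarith [A.η_pos]), A.collar₁ t 1 (by linarith [A.η_pos]), hst])
    obtain ⟨-, m, hm⟩ := h
    exact ⟨m, by simp at hm; linarith⟩

/-- The partial derivative in `θ` of the annulus on the upper collar is `(k₂', 0)`. [folklore] -/
theorem hasDerivAt_F_two (θ : ℝ) : HasDerivAt (fun t ↦ A.F (t, 2)) (deriv A.k₂ θ, 0) θ := by
  have hfun : (fun t ↦ A.F (t, 2)) = fun t ↦ (A.k₂ t, (2 : ℝ)) := funext fun t ↦ A.collar₂ t 2 (by linarith [A.η_pos])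
  rw [hfun]
  exact ((A.contDiff_k₂.differentiable (by simp)) θ).hasDerivAt.prodMk (hasDerivAt_const θ (2 : ℝ))

/-- **The upper end curve of a long annulus is a chart loop.** [folklore] -/
theorem isChartLoop_k₂ : IsChartLoop A.k₂ where
  contDiff := A.contDiff_k₂
  periodic θ := by rw [A.k₂_eq, A.k₂_eq, A.F_add_one]
  deriv_ne_zero θ h0 := by
    have hinj := A.injective_fderiv (θ, 2) ⟨by norm_num, le_rfl⟩
    have hF : DifferentiableAt ℝ A.F (θ, 2) := (A.contDiff_F.differentiable (by simp)) _
    have hline : HasDerivAt (fun t : ℝ ↦ ((t, (2 : ℝ)) : ℝ × ℝ)) ((1 : ℝ), (0 : ℝ)) θ :=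
      (hasDerivAt_id θ).prodMk (hasDerivAt_const θ (2 : ℝ))
    have hcomp := hF.hasFDerivAt.comp_hasDerivAt θ hline
    have h1 := hcomp.unique (A.hasDerivAt_F_two θ)
    rw [h0] at h1
    have h2 : fderiv ℝ A.F (θ, 2) ((1 : ℝ), (0 : ℝ)) = 0 := by rw [h1]; rfl
    have := hinj (h2.trans (map_zero _).symm)
    simp at this
  inj s t hst := by
    have h := A.inj (s, 2) (t, 2) ⟨by norm_num, le_rfl⟩ ⟨by norm_num, le_rfl⟩
      (by rw [A.collar₂ s 2 (by linarith [A.η_pos]), A.collar₂ t 2 (by linarith [A.η_pos]), hst])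
    obtain ⟨-, m, hm⟩ := h
    exact ⟨m, by simp at hm; linarith⟩

end LongAnnulus

/-! ### The cut-off -/

namespace InvertedPicture

/-- **The cut-off** `= 1` on `|w| ≤ a/16`, `= 0` off `(-a/8, a/8)`, values in `[0, 1]`, built
from `Real.smoothTransition`. [folklore] -/
def cutoff (a w : ℝ) : ℝ :=
  Real.smoothTransition ((a / 8 - w) / (a / 16)) * Real.smoothTransition ((a / 8 + w) / (a / 16))

/-- The cut-off is `C^∞`. [folklore] -/
theorem contDiff_cutoff (a : ℝ) : ContDiff ℝ ∞ (cutoff a) :=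
  (Real.smoothTransition.contDiff.comp ((contDiff_const.sub contDiff_id).div_const _)).mul
    (Real.smoothTransition.contDiff.comp ((contDiff_const.add contDiff_id).div_const _))

/-- `0 ≤ cutoff ≤ 1`. [folklore] -/
theorem cutoff_mem (a w : ℝ) : cutoff a w ∈ Icc (0 : ℝ) 1 :=
  ⟨mul_nonneg (Real.smoothTransition.nonneg _) (Real.smoothTransition.nonneg _),
    mul_le_one₀ (Real.smoothTransition.le_one _) (Real.smoothTransition.nonneg _) (Real.smoothTransition.le_one _)⟩

/-- `cutoff = 1` on `|w| ≤ a/16` (`a > 0`). [folklore] -/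
theorem cutoff_eq_one {a w : ℝ} (ha : 0 < a) (hw : |w| ≤ a / 16) : cutoff a w = 1 := by
  rw [abs_le] at hw
  rw [cutoff, Real.smoothTransition.one_of_one_le, Real.smoothTransition.one_of_one_le, mul_one]
  · rw [le_div_iff₀ (by positivity)]; linarith
  · rw [le_div_iff₀ (by positivity)]; linarith

/-- `cutoff = 0` off `(-a/8, a/8)` (`a > 0`). [folklore] -/
theorem cutoff_eq_zero {a w : ℝ} (ha : 0 < a) (hw : a / 8 ≤ |w|) : cutoff a w = 0 := by
  rw [cutoff]
  rcases le_abs'.1 hw with h | h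
  · rw [Real.smoothTransition.zero_of_nonpos (x := (a / 8 + w) / (a / 16)), mul_zero]
    exact div_nonpos_of_nonpos_of_nonneg (by linarith) (by positivity)
  · rw [Real.smoothTransition.zero_of_nonpos (x := (a / 8 - w) / (a / 16)), zero_mul]
    exact div_nonpos_of_nonpos_of_nonneg (by linarith) (by positivity)

end InvertedPicture

/-! ### A long annulus with a flat strip -/

/-- **A flat strip of a long annulus**: the positions over the parameter strip
`|θ - θ₁ - m| < δ₁` (`m ∈ ℤ`) are the straight unit-speed segment `x₀ + 2π(θ - θ₁ - m) e` at
the true level, and every other position is at distance at least `r'` from `x₀` (`e` a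
horizontal unit vector; `r' ≤ 1` without loss). [folklore] -/
structure StripPicture {η : ℝ} (D : LongAnnulus η) where
  /-- The base point of the strip. -/
  x₀ : 𝔼 3
  /-- The direction of the strip. -/
  e : 𝔼 3
  /-- The parameter of the base point. -/
  θ₁ : ℝ
  /-- The half-width of the parameter strip. -/
  δ₁ : ℝ
  /-- The body-free radius. -/
  r' : ℝ
  norm_e : ‖e‖ = 1
  e_two : e 2 = 0
  δ₁_pos : 0 < δ₁
  r'_pos : 0 < r'
  r'_le : r' ≤ 1
  strip : ∀ θ s (m : ℤ), |θ - θ₁ - m| < δ₁ → D.F (θ, s) = (x₀ + (2 * π * (θ - θ₁ - m)) • e, s)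
  bodyFree : ∀ θ s, ‖(D.F (θ, s)).1 - x₀‖ < r' → ∃ m : ℤ, |θ - θ₁ - m| < δ₁

namespace StripPicture

variable {η : ℝ} {D : LongAnnulus η} (S : StripPicture D)

/-- The ring diameter `a = r'/8`. [folklore] -/
def a : ℝ := S.r' / 8

/-- `0 < a`. [folklore] -/
theorem a_pos : 0 < S.a := by rw [a]; linarith [S.r'_pos]

/-- `a < r'`. [folklore] -/
theorem a_lt_r' : S.a < S.r' := by rw [a]; linarith [S.r'_pos]

/-- `r' - a = 7a`. [folklore] -/
theorem r'_sub_a : S.r' - S.a = 7 * S.a := by rw [a]; ring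

/-- The blob radius `a²/(r' - a) = a/7`. [folklore] -/
theorem blob_radius : S.a ^ 2 / (S.r' - S.a) = S.a / 7 := by
  rw [S.r'_sub_a]; have := S.a_pos; field_simp

/-- The cut-off of the picture. [folklore] -/
def φ : ℝ → ℝ := cutoff S.a

/-- The map of the inverted picture. [folklore] -/
def Ψ : 𝔼 3 → 𝔼 3 := InvertedPicture.Ψ S.x₀ S.e S.a S.φ

/-- The cut-off facts in the form consumed by `InvertedPicture.lean`. [folklore] -/
theorem φ_facts : ContDiff ℝ ∞ S.φ ∧ (∀ w, 0 ≤ S.φ w) ∧ (∀ w, S.φ w ≤ 1) ∧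
    S.a / 8 < S.a / 2 ∧ (∀ w, S.a / 8 ≤ |w| → S.φ w = 0) ∧ ∀ w, |w| ≤ S.a / 16 → S.φ w = 1 :=
  ⟨contDiff_cutoff _, fun w ↦ (cutoff_mem _ w).1, fun w ↦ (cutoff_mem _ w).2, by linarith [S.a_pos],
    fun _ hw ↦ cutoff_eq_zero S.a_pos hw, fun _ hw ↦ cutoff_eq_one S.a_pos hw⟩

/-! ### The dichotomy: strip points and far points -/

/-- **Every position is a strip point or a far point.** [folklore] -/
theorem dichotomy (θ s : ℝ) :
    (∃ u : ℝ, (D.F (θ, s)).1 = S.x₀ + u • S.e ∧ (D.F (θ, s)).2 = s) ∨ S.r' ≤ ‖(D.F (θ, s)).1 - S.x₀‖ := by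
  by_cases h : ‖(D.F (θ, s)).1 - S.x₀‖ < S.r'
  · obtain ⟨m, hm⟩ := S.bodyFree θ s h
    left
    refine ⟨2 * π * (θ - S.θ₁ - m), ?_, ?_⟩ <;> simp [S.strip θ s m hm]
  · exact Or.inr (not_lt.1 h)

/-- Positions avoid the centre of the inversion. [folklore] -/
theorem pos_ne_ctr (θ s : ℝ) : (D.F (θ, s)).1 ≠ ctr S.x₀ S.a := by
  intro h
  rcases S.dichotomy θ s with ⟨u, hu, -⟩ | hfar
  · -- a line point is not the centre: compare heights
    have := congrArg (fun x : 𝔼 3 ↦ x 2) (hu.symm.trans h)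
    simp [ctr, v₃_apply, S.e_two] at this
    exact (S.a_pos.ne' this).elim
  · rw [h, show ctr S.x₀ S.a - S.x₀ = S.a • v₃ by rw [ctr]; abel, norm_smul, norm_v₃, mul_one, Real.norm_eq_abs,
      abs_of_pos S.a_pos] at hfar
    linarith [S.a_lt_r']

/-- The end curves avoid the centre. [folklore] -/
theorem k₁_ne_ctr (t : ℝ) : D.k₁ t ≠ ctr S.x₀ S.a := by rw [D.k₁_eq]; exact S.pos_ne_ctr t 1

/-- The end curves avoid the centre. [folklore] -/
theorem k₂_ne_ctr (t : ℝ) : D.k₂ t ≠ ctr S.x₀ S.a := by rw [D.k₂_eq]; exact S.pos_ne_ctr t 2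

/-! ### The inverted end knots -/

/-- **The inverted lower end curve is a chart loop, with a knot isotopic to that of `D.k₁`.**
[folklore] -/
theorem isChartLoop_Ψk₁ : IsChartLoop (fun t ↦ S.Ψ (D.k₁ t)) ∧
    ∀ h' : IsChartLoop (fun t ↦ S.Ψ (D.k₁ t)), D.isChartLoop_k₁.toKnot.IsIsotopic h'.toKnot := by
  obtain ⟨hφ, -, -, hw₂, hsupp, -⟩ := S.φ_facts
  exact isChartLoop_Ψ D.isChartLoop_k₁ S.norm_e S.e_two S.a_pos hφ hw₂ hsupp S.k₁_ne_ctr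

/-- **The inverted upper end curve is a chart loop, with a knot isotopic to that of `D.k₂`.**
[folklore] -/
theorem isChartLoop_Ψk₂ : IsChartLoop (fun t ↦ S.Ψ (D.k₂ t)) ∧
    ∀ h' : IsChartLoop (fun t ↦ S.Ψ (D.k₂ t)), D.isChartLoop_k₂.toKnot.IsIsotopic h'.toKnot := by
  obtain ⟨hφ, -, -, hw₂, hsupp, -⟩ := S.φ_facts
  exact isChartLoop_Ψ D.isChartLoop_k₂ S.norm_e S.e_two S.a_pos hφ hw₂ hsupp S.k₂_ne_ctr

/-- **The inverted lower end knot.** [folklore] -/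
def Kn₁ : Knot := S.isChartLoop_Ψk₁.1.toKnot

/-- **The inverted upper end knot.** [folklore] -/
def Kn₂ : Knot := S.isChartLoop_Ψk₂.1.toKnot

/-- The inverted lower end knot is isotopic to the knot of `D.k₁`. [folklore] -/
theorem isIsotopic_Kn₁ : D.isChartLoop_k₁.toKnot.IsIsotopic S.Kn₁ := S.isChartLoop_Ψk₁.2 _

/-- The inverted upper end knot is isotopic to the knot of `D.k₂`. [folklore] -/
theorem isIsotopic_Kn₂ : D.isChartLoop_k₂.toKnot.IsIsotopic S.Kn₂ := S.isChartLoop_Ψk₂.2 _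

/-- The chart curve of `Kn₁`. [folklore] -/
theorem psi_Kn₁ (θ : ℝ) : psi (S.Kn₁ (circlePoint θ)) = S.Ψ (D.k₁ ((2 * π)⁻¹ * θ)) :=
  S.isChartLoop_Ψk₁.1.psi_toKnot_circlePoint θ

/-- The chart curve of `Kn₂`. [folklore] -/
theorem psi_Kn₂ (θ : ℝ) : psi (S.Kn₂ (circlePoint θ)) = S.Ψ (D.k₂ ((2 * π)⁻¹ * θ)) :=
  S.isChartLoop_Ψk₂.1.psi_toKnot_circlePoint θ

/-- `Kn₁` misses the south pole. [folklore] -/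
theorem Kn₁_ne_southPole (y : 𝕊 1) : S.Kn₁ y ≠ southPole := S.isChartLoop_Ψk₁.1.toKnot_ne_southPole y

/-- `Kn₂` misses the south pole. [folklore] -/
theorem Kn₂_ne_southPole (y : 𝕊 1) : S.Kn₂ y ≠ southPole := S.isChartLoop_Ψk₂.1.toKnot_ne_southPole y

/-! ### Geometry of the inverted pictures: every image point -/

/-- The numerical facts `ρ = a/7 ≤ a/4`, `Hb ρ ≤ a/8`, `Hb (a/8) ≤ a/8`. [folklore] -/
theorem numerics : S.a ^ 2 / (S.r' - S.a) ≤ S.a / 4 ∧ Hb S.a (S.a ^ 2 / (S.r' - S.a)) ≤ S.a / 8 ∧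
    Hb S.a (S.a / 8) ≤ S.a / 8 := by
  have ha := S.a_pos
  have hq := Hb_quarter_le ha.le
  rw [S.blob_radius]
  refine ⟨by linarith, ?_, ?_⟩
  · exact (Hb_mono S.a (by rw [abs_of_pos (by positivity), abs_of_pos (by positivity)]; linarith)).trans hq
  · exact (Hb_mono S.a (by rw [abs_of_pos (by positivity), abs_of_pos (by positivity)]; linarith)).trans hq

/-- **Heights are nonnegative**: `x₀ 2 ≤ (Ψ pos) 2` for every position of the annulus. [folklore] -/
theorem height_nonneg (θ s : ℝ) : S.x₀ 2 ≤ S.Ψ (D.F (θ, s)).1 2 := by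
  obtain ⟨-, -, hφ1, -, -, -⟩ := S.φ_facts
  rcases S.dichotomy θ s with ⟨u, hu, -⟩ | hfar
  · rw [hu]; exact height_line_nonneg S.norm_e S.e_two S.a_pos hφ1 u
  · have h := height_far (φ := S.φ) S.norm_e S.e_two S.a_pos.le S.a_lt_r' hφ1 hfar
    obtain ⟨h1, h2, -⟩ := S.numerics
    have ha := S.a_pos
    change S.x₀ 2 ≤ InvertedPicture.Ψ S.x₀ S.e S.a S.φ (D.F (θ, s)).1 2
    linarith

/-- **Far positions are high**: `(Ψ pos) 2 ≥ x₀ 2 + 5a/8` for a far position. [folklore] -/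
theorem height_far' {x : 𝔼 3} (hx : S.r' ≤ ‖x - S.x₀‖) : S.x₀ 2 + 5 * S.a / 8 ≤ S.Ψ x 2 := by
  obtain ⟨-, -, hφ1, -, -, -⟩ := S.φ_facts
  have h := height_far (φ := S.φ) S.norm_e S.e_two S.a_pos.le S.a_lt_r' hφ1 hx
  obtain ⟨h1, h2, -⟩ := S.numerics
  change _ ≤ InvertedPicture.Ψ S.x₀ S.e S.a S.φ x 2
  linarith

/-- **Far positions are horizontally close to `x₀`**: `|⟪Ψ x - x₀, e⟫| ≤ a/4`. [folklore] -/
theorem abs_inner_far {x : 𝔼 3} (hx : S.r' ≤ ‖x - S.x₀‖) : |⟪S.Ψ x - S.x₀, S.e⟫| ≤ S.a / 4 :=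
  (abs_inner_Ψ_far (φ := S.φ) S.norm_e S.e_two S.a_pos.le S.a_lt_r' hx).trans S.numerics.1

/-- **Far positions are near the centre**: `dist (Ψ x) ctr ≤ 3a/8`. [folklore] -/
theorem dist_far {x : 𝔼 3} (hx : S.r' ≤ ‖x - S.x₀‖) : dist (S.Ψ x) (ctr S.x₀ S.a) ≤ 3 * S.a / 8 := by
  obtain ⟨-, hφ0, hφ1, -, -, -⟩ := S.φ_facts
  have h := dist_Ψ_ctr_far (φ := S.φ) S.norm_e S.e_two S.a_pos.le S.a_lt_r' hφ0 hφ1 hx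
  obtain ⟨h1, h2, -⟩ := S.numerics
  change dist (InvertedPicture.Ψ S.x₀ S.e S.a S.φ x) _ ≤ _
  linarith

/-- **Upper-ring line points are high**: `(Ψ (x₀ + u e)) 2 ≥ x₀ 2 + 3a/8` for `|u| ≥ a`. [folklore] -/
theorem height_upper {u : ℝ} (hu : S.a ≤ |u|) : S.x₀ 2 + 3 * S.a / 8 ≤ S.Ψ (S.x₀ + u • S.e) 2 := by
  obtain ⟨-, -, hφ1, -, hsupp, -⟩ := S.φ_facts
  have h := height_line_upper (x₀ := S.x₀) (φ := S.φ) S.norm_e S.e_two S.a_pos hφ1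
    (by linarith [S.a_pos] : (0 : ℝ) ≤ S.a / 8) hsupp hu
  have h3 := S.numerics.2.2
  change _ ≤ InvertedPicture.Ψ S.x₀ S.e S.a S.φ (S.x₀ + u • S.e) 2
  linarith

/-- **The lower-ring line points**: for `|u| ≤ a`, `Ψ (x₀ + u e) = x₀ + W u • e + c • v₃` with
`0 ≤ c`, and `c = 0` when `|W u| ≤ a/16`. [folklore] -/
theorem line_lower {u : ℝ} (hu : |u| ≤ S.a) :
    ∃ c : ℝ, 0 ≤ c ∧ (|W S.a u| ≤ S.a / 16 → c = 0) ∧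
      S.Ψ (S.x₀ + u • S.e) = S.x₀ + W S.a u • S.e + c • v₃ := by
  obtain ⟨-, -, hφ1, -, -, hone⟩ := S.φ_facts
  refine ⟨InvertedPicture.H S.a u - S.φ (W S.a u) * Hb S.a (W S.a u), ?_, fun hw ↦ ?_, ?_⟩
  · rw [H_eq_Hb S.a_pos hu]; nlinarith [hφ1 (W S.a u), Hb_nonneg S.a_pos.le (W S.a u)]
  · rw [hone _ hw, one_mul, H_eq_Hb S.a_pos hu, sub_self]
  · exact Ψ_line S.norm_e S.e_two S.a_pos u

/-- Norm bound of the picture: `‖Ψ pos‖ ≤ ‖x₀‖ + 2a` for every position. [folklore] -/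
theorem norm_Ψ_le (θ s : ℝ) : ‖S.Ψ (D.F (θ, s)).1‖ ≤ ‖S.x₀‖ + 2 * S.a := by
  obtain ⟨-, hφ0, hφ1, -, -, -⟩ := S.φ_facts
  have ha := S.a_pos
  rcases S.dichotomy θ s with ⟨u, hu, -⟩ | hfar
  · rw [hu]
    change ‖InvertedPicture.Ψ S.x₀ S.e S.a S.φ (S.x₀ + u • S.e)‖ ≤ _
    rw [Ψ_line S.norm_e S.e_two S.a_pos u, add_assoc]
    refine (norm_add_le _ _).trans ?_
    gcongr
    refine (norm_add_le _ _).trans ?_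
    rw [norm_smul, norm_smul, S.norm_e, norm_v₃, mul_one, mul_one, Real.norm_eq_abs, Real.norm_eq_abs]
    have h1 := abs_W_le_half ha u
    have h2 : |InvertedPicture.H S.a u - S.φ (W S.a u) * Hb S.a (W S.a u)| ≤ S.a := by
      rw [abs_le]
      have := H_nonneg ha.le u
      have := H_le ha.le u
      have := Hb_nonneg ha.le (W S.a u)
      have := Hb_le_half S.a (W S.a u)
      constructor <;> nlinarith [hφ0 (W S.a u), hφ1 (W S.a u)]
    linarith
  · have hd := S.dist_far hfar
    rw [dist_eq_norm] at hd
    calc ‖S.Ψ (D.F (θ, s)).1‖ ≤ ‖S.Ψ (D.F (θ, s)).1 - ctr S.x₀ S.a‖ + ‖ctr S.x₀ S.a‖ := norm_le_norm_sub_add _ _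
      _ ≤ 3 * S.a / 8 + (‖S.x₀‖ + S.a) := by
          gcongr
          rw [ctr]
          refine (norm_add_le _ _).trans ?_
          rw [norm_smul, norm_v₃, mul_one, Real.norm_eq_abs, abs_of_pos ha]
      _ ≤ _ := by linarith

/-! ### The strip is at least as long as the body-free radius -/

/-- `a ≤ 1/8`. [folklore] -/
theorem a_le : S.a ≤ 1 / 8 := by rw [a]; linarith [S.r'_le]

/-- **The strip reaches the body-free sphere**: `r' ≤ 2π δ₁`. [folklore] -/
theorem r'_le_two_pi_δ₁ : S.r' ≤ 2 * π * S.δ₁ := by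
  by_contra hlt
  push Not at hlt
  set t := S.θ₁ + S.δ₁ with ht
  -- the position at the end of the strip, by continuity
  have hcont : Continuous fun θ ↦ (D.F (θ, 1)).1 :=
    continuous_fst.comp (D.contDiff_F.continuous.comp (continuous_id.prodMk continuous_const))
  have hlim : Tendsto (fun θ ↦ (D.F (θ, 1)).1) (𝓝[<] t) (𝓝 (S.x₀ + (2 * π * S.δ₁) • S.e)) := by
    have heq : ∀ᶠ θ in 𝓝[<] t, (D.F (θ, 1)).1 = S.x₀ + (2 * π * (θ - S.θ₁)) • S.e := by
      have hmem : Ioo (t - S.δ₁) t ∈ 𝓝[<] t := Ioo_mem_nhdsLT (by linarith [S.δ₁_pos])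
      filter_upwards [hmem] with θ hθ
      have h := S.strip θ 1 0 (by simp only [Int.cast_zero, sub_zero]; rw [abs_lt]; constructor <;> linarith [hθ.1, hθ.2])
      simp [h]
    have hc : Tendsto (fun θ : ℝ ↦ S.x₀ + (2 * π * (θ - S.θ₁)) • S.e) (𝓝[<] t) (𝓝 (S.x₀ + (2 * π * S.δ₁) • S.e)) := by
      have : Continuous fun θ : ℝ ↦ S.x₀ + (2 * π * (θ - S.θ₁)) • S.e := by fun_prop
      have h1 := this.tendsto t
      rw [show 2 * π * (t - S.θ₁) = 2 * π * S.δ₁ by rw [ht]; ring] at h1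
      exact h1.mono_left nhdsWithin_le_nhds
    exact hc.congr' (heq.mono fun θ h ↦ h.symm)
  have hval : (D.F (t, 1)).1 = S.x₀ + (2 * π * S.δ₁) • S.e :=
    tendsto_nhds_unique ((hcont.tendsto t).mono_left nhdsWithin_le_nhds) hlim
  -- hence a strip point for some `m`, forcing `m = 0` and `|δ₁| < δ₁`
  have hnorm : ‖(D.F (t, 1)).1 - S.x₀‖ < S.r' := by
    rw [hval, add_sub_cancel_left, norm_smul, S.norm_e, mul_one, Real.norm_eq_abs,
      abs_of_pos (by have := S.δ₁_pos; positivity)]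
    exact hlt
  obtain ⟨m, hm⟩ := S.bodyFree t 1 hnorm
  have hstrip := S.strip t 1 m hm
  have h1 : (2 * π * (t - S.θ₁ - m)) • S.e = (2 * π * S.δ₁) • S.e := by
    have := congrArg Prod.fst hstrip
    rw [hval] at this
    exact (add_left_cancel this).symm
  have h2 : 2 * π * (t - S.θ₁ - m) = 2 * π * S.δ₁ :=
    smul_left_injective ℝ (by rw [← norm_ne_zero_iff, S.norm_e]; norm_num) h1
  have hm0 : (m : ℝ) = 0 := by rw [ht] at h2; nlinarith [Real.pi_pos]
  rw [ht, hm0, sub_zero, add_sub_cancel_left, abs_of_pos S.δ₁_pos] at hm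
  exact lt_irrefl _ hm

/-- `a/16 < 2π δ₁`. [folklore] -/
theorem window_lt : S.a / 16 < 2 * π * S.δ₁ := by
  have := S.r'_le_two_pi_δ₁; have := S.a_lt_r'; have := S.a_pos; linarith

/-! ### The flat-arc normal form of the inverted end knots -/

/-- The half-length `ℓ = W a (a/16)` of the window. [folklore] -/
def ℓ : ℝ := W S.a (S.a / 16)

/-- `0 < ℓ`. [folklore] -/
theorem ℓ_pos : 0 < S.ℓ := by
  rw [ℓ, W]; have := S.a_pos; positivity

/-- `ℓ ≤ a/16`. [folklore] -/
theorem ℓ_le : S.ℓ ≤ S.a / 16 := by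
  have h := abs_W_le (S.a / 16) S.a_pos (a := S.a)
  rw [abs_of_pos (by linarith [S.a_pos] : (0 : ℝ) < S.a / 16)] at h
  exact (le_abs_self _).trans h

/-- The traversal `σM θ = W a (θ - 2π θ₁)` of the window. [folklore] -/
def σM (θ : ℝ) : ℝ := W S.a (θ - 2 * π * S.θ₁)

/-- The chart picture of the end knots at a parameter, from the annulus. [folklore] -/
theorem psi_Kn₁_circlePt (t : ℝ) : psi (S.Kn₁ (circlePt t)) = S.Ψ (D.F (t, 1)).1 := by
  rw [Kn₁, IsChartLoop.psi_toKnot_circlePt, D.k₁_eq]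

/-- The chart picture of the end knots at a parameter, from the annulus. [folklore] -/
theorem psi_Kn₂_circlePt (t : ℝ) : psi (S.Kn₂ (circlePt t)) = S.Ψ (D.F (t, 2)).1 := by
  rw [Kn₂, IsChartLoop.psi_toKnot_circlePt, D.k₂_eq]

/-- **Lowest**: the whole picture lies above the height of `x₀` (any level). [folklore] -/
theorem lowest (θ s : ℝ) : S.x₀ 2 ≤ S.Ψ (D.F (θ, s)).1 2 := S.height_nonneg θ s

/-- **Box**: a picture point (any level) horizontally within `ℓ` of `x₀` and lower than
`x₀ 2 + a/4` is on the window segment. [folklore] -/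
theorem box (θ s : ℝ) (h1 : |⟪S.Ψ (D.F (θ, s)).1 - S.x₀, S.e⟫| < S.ℓ)
    (h2 : S.Ψ (D.F (θ, s)).1 2 < S.x₀ 2 + S.a / 4) :
    ∃ w ∈ Icc (-S.ℓ) S.ℓ, S.Ψ (D.F (θ, s)).1 = S.x₀ + w • S.e := by
  have ha := S.a_pos
  rcases S.dichotomy θ s with ⟨u, hu, -⟩ | hfar
  · rw [hu] at h1 h2 ⊢
    rcases le_or_gt |u| S.a with hua | hua
    · obtain ⟨c, hc0, hc, hΨ⟩ := S.line_lower hua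
      have hw : ⟪S.Ψ (S.x₀ + u • S.e) - S.x₀, S.e⟫ = W S.a u := by
        rw [hΨ, show S.x₀ + W S.a u • S.e + c • v₃ - S.x₀ = W S.a u • S.e + c • v₃ by abel, inner_add_left,
          inner_smul_left, inner_smul_left, real_inner_self_eq_norm_sq, S.norm_e, inner_v₃_left_of_horizontal S.e_two]
        simp
      rw [hw] at h1
      have hc' : c = 0 := hc (by linarith [h1.le, S.ℓ_le])
      refine ⟨W S.a u, ⟨by linarith [(abs_lt.1 h1).1], by linarith [(abs_lt.1 h1).2]⟩, ?_⟩
      rw [hΨ, hc', zero_smul, add_zero]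
    · have := S.height_upper hua.le
      linarith
  · have := S.height_far' hfar
    linarith

/-- **Segment**: the window traversal of the lower end knot. [folklore] -/
theorem seg₁ {θ : ℝ} (hθ : θ ∈ Icc (2 * π * S.θ₁ - S.a / 16) (2 * π * S.θ₁ + S.a / 16)) :
    psi (S.Kn₁ (circlePoint θ)) = S.x₀ + S.σM θ • S.e := by
  have hπ := Real.pi_pos
  have ht : |(2 * π)⁻¹ * θ - S.θ₁ - (0 : ℤ)| < S.δ₁ := by
    simp only [Int.cast_zero, sub_zero]
    have hw := S.window_lt
    rw [abs_lt]
    constructor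
    · have : 2 * π * (S.θ₁ - S.δ₁) < θ := by nlinarith [hθ.1]
      have h2 : S.θ₁ - S.δ₁ < (2 * π)⁻¹ * θ := by
        rw [lt_inv_mul_iff₀ (by positivity)]; exact this
      linarith
    · have : θ < 2 * π * (S.θ₁ + S.δ₁) := by nlinarith [hθ.2]
      have h2 : (2 * π)⁻¹ * θ < S.θ₁ + S.δ₁ := by
        rw [inv_mul_lt_iff₀ (by positivity)]; exact this
      linarith
  have hstrip := S.strip ((2 * π)⁻¹ * θ) 1 0 ht
  rw [S.psi_Kn₁, D.k₁_eq, hstrip]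
  simp only [Int.cast_zero, sub_zero]
  have hu : 2 * π * ((2 * π)⁻¹ * θ - S.θ₁) = θ - 2 * π * S.θ₁ := by field_simp
  rw [hu]
  have hua : |θ - 2 * π * S.θ₁| ≤ S.a := by rw [abs_le]; constructor <;> linarith [hθ.1, hθ.2, S.a_pos]
  have hw : |W S.a (θ - 2 * π * S.θ₁)| ≤ S.a / 16 :=
    (abs_W_le S.a _ S.a_pos).trans (by rw [abs_le]; constructor <;> linarith [hθ.1, hθ.2])
  obtain ⟨-, -, -, -, -, hone⟩ := S.φ_facts
  exact Ψ_window S.norm_e S.e_two S.a_pos hua (hone _ hw)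

/-- **Segment**: the window traversal of the upper end knot (the same window). [folklore] -/
theorem seg₂ {θ : ℝ} (hθ : θ ∈ Icc (2 * π * S.θ₁ - S.a / 16) (2 * π * S.θ₁ + S.a / 16)) :
    psi (S.Kn₂ (circlePoint θ)) = S.x₀ + S.σM θ • S.e := by
  have hπ := Real.pi_pos
  have ht : |(2 * π)⁻¹ * θ - S.θ₁ - (0 : ℤ)| < S.δ₁ := by
    simp only [Int.cast_zero, sub_zero]
    have hw := S.window_lt
    rw [abs_lt]
    constructor
    · have : 2 * π * (S.θ₁ - S.δ₁) < θ := by nlinarith [hθ.1]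
      have h2 : S.θ₁ - S.δ₁ < (2 * π)⁻¹ * θ := by
        rw [lt_inv_mul_iff₀ (by positivity)]; exact this
      linarith
    · have : θ < 2 * π * (S.θ₁ + S.δ₁) := by nlinarith [hθ.2]
      have h2 : (2 * π)⁻¹ * θ < S.θ₁ + S.δ₁ := by
        rw [inv_mul_lt_iff₀ (by positivity)]; exact this
      linarith
  have hstrip := S.strip ((2 * π)⁻¹ * θ) 2 0 ht
  rw [S.psi_Kn₂, D.k₂_eq, hstrip]
  simp only [Int.cast_zero, sub_zero]
  have hu : 2 * π * ((2 * π)⁻¹ * θ - S.θ₁) = θ - 2 * π * S.θ₁ := by field_simp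
  rw [hu]
  have hua : |θ - 2 * π * S.θ₁| ≤ S.a := by rw [abs_le]; constructor <;> linarith [hθ.1, hθ.2, S.a_pos]
  have hw : |W S.a (θ - 2 * π * S.θ₁)| ≤ S.a / 16 :=
    (abs_W_le S.a _ S.a_pos).trans (by rw [abs_le]; constructor <;> linarith [hθ.1, hθ.2])
  obtain ⟨-, -, -, -, -, hone⟩ := S.φ_facts
  exact Ψ_window S.norm_e S.e_two S.a_pos hua (hone _ hw)

/-- `σM` is `C^∞`. [folklore] -/
theorem contDiff_σM : ContDiff ℝ ∞ S.σM := (contDiff_W S.a_pos).comp (contDiff_id.sub contDiff_const)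

/-- `σM' > 0` on the window. [folklore] -/
theorem deriv_σM_pos {θ : ℝ} (hθ : θ ∈ Icc (2 * π * S.θ₁ - S.a / 16) (2 * π * S.θ₁ + S.a / 16)) :
    0 < deriv S.σM θ := by
  have : S.σM = fun θ ↦ W S.a (θ - 2 * π * S.θ₁) := rfl
  rw [this, deriv_comp_sub_const]
  exact deriv_W_pos S.a_pos (by rw [abs_lt]; constructor <;> linarith [hθ.1, hθ.2, S.a_pos])

/-- `σM` at the ends of the window. [folklore] -/
theorem σM_ends : S.σM (2 * π * S.θ₁ - S.a / 16) = -S.ℓ ∧ S.σM (2 * π * S.θ₁ + S.a / 16) = S.ℓ := by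
  refine ⟨?_, ?_⟩
  · rw [σM, ℓ, show 2 * π * S.θ₁ - S.a / 16 - 2 * π * S.θ₁ = -(S.a / 16) by ring, W_neg]
  · rw [σM, ℓ, show 2 * π * S.θ₁ + S.a / 16 - 2 * π * S.θ₁ = S.a / 16 by ring]

/-! ### The model data -/

/-- **The model data of the inverted lower end knot**, for given sizes: band height `am`,
scale `l`, collar width `δ` subject to the smallness conditions of `ModelData`. [folklore] -/
def modelData₁ (sg : ℝ) (hsg : sg ^ 2 = 1) (am l δ : ℝ) (ham : 0 < am) (hl : 0 < l) (hδ : 0 < δ) (hδ8 : δ ≤ 1 / 8)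
    (hl_le : 16 * l * (‖S.x₀‖ + 2 * S.a + 1) ≤ am)
    (hδ_room : δ * (16 * am * (‖S.x₀‖ + 2 * S.a + 1)) ≤ l)
    (hδ_up : δ * (16 * (‖S.x₀‖ + 2 * S.a + 1) ^ 2) < 1)
    (hδ_clean : δ * (2 * am) ≤ l * (S.a / 4)) : ModelData where
  Kn := S.Kn₁
  hKn := S.Kn₁_ne_southPole
  p := S.x₀
  e := S.e
  ℓ := S.ℓ
  ν := S.a / 4
  α := 2 * π * S.θ₁ - S.a / 16
  β := 2 * π * S.θ₁ + S.a / 16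
  σ := S.σM
  norm_e := S.norm_e
  e_two := S.e_two
  ℓ_pos := S.ℓ_pos
  ν_pos := by linarith [S.a_pos]
  lowest y := by rw [← circlePt_angA y, S.psi_Kn₁_circlePt]; exact S.lowest _ _
  box y h1 h2 := by
    rw [← circlePt_angA y, S.psi_Kn₁_circlePt] at h1 h2 ⊢
    exact S.box _ _ h1 h2
  α_lt_β := by linarith [S.a_pos]
  β_lt := by have := S.a_le; linarith [Real.pi_gt_three]
  contDiff_σ := S.contDiff_σM
  deriv_σ_pos θ hθ := S.deriv_σM_pos hθ
  σ_α := S.σM_ends.1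
  σ_β := S.σM_ends.2
  seg θ hθ := S.seg₁ hθ
  Rb := ‖S.x₀‖ + 2 * S.a
  ρ' := ‖S.x₀‖ + 2 * S.a + 1
  norm_le y := by rw [← circlePt_angA y, S.psi_Kn₁_circlePt]; exact S.norm_Ψ_le _ _
  ρ'_ge := le_rfl
  M := frameOf S.norm_e S.e_two (s := sg) hsg
  M_zero v := frameOf_zero _ _ _ v
  M_one v := frameOf_one _ _ _ v
  norm_M v := norm_frameOf _ _ _ v
  a := am
  l := l
  δ := δ
  a_pos := ham
  l_pos := hl
  δ_pos := hδ
  δ_le := hδ8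
  l_le := hl_le
  δ_room := hδ_room
  δ_up := hδ_up
  δ_clean := hδ_clean

section

variable (sg : ℝ) (hsg : sg ^ 2 = 1) (am l δ : ℝ) (ham : 0 < am) (hl : 0 < l) (hδ : 0 < δ) (hδ8 : δ ≤ 1 / 8)
    (hl_le : 16 * l * (‖S.x₀‖ + 2 * S.a + 1) ≤ am)
    (hδ_room : δ * (16 * am * (‖S.x₀‖ + 2 * S.a + 1)) ≤ l)
    (hδ_up : δ * (16 * (‖S.x₀‖ + 2 * S.a + 1) ^ 2) < 1)
    (hδ_clean : δ * (2 * am) ≤ l * (S.a / 4))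

/-- The second summand of the model. [folklore] -/
@[simp] theorem modelData₁_Kn : (S.modelData₁ sg hsg am l δ ham hl hδ hδ8 hl_le hδ_room hδ_up hδ_clean).Kn = S.Kn₁ := rfl

/-- The flat point of the model. [folklore] -/
@[simp] theorem modelData₁_p : (S.modelData₁ sg hsg am l δ ham hl hδ hδ8 hl_le hδ_room hδ_up hδ_clean).p = S.x₀ := rfl

/-- The direction of the model. [folklore] -/
@[simp] theorem modelData₁_e : (S.modelData₁ sg hsg am l δ ham hl hδ hδ8 hl_le hδ_room hδ_up hδ_clean).e = S.e := rfl

/-- The model radius. [folklore] -/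
@[simp] theorem modelData₁_ρ' :
    (S.modelData₁ sg hsg am l δ ham hl hδ hδ8 hl_le hδ_room hδ_up hδ_clean).ρ' = ‖S.x₀‖ + 2 * S.a + 1 := rfl

/-- The traversal of the model. [folklore] -/
@[simp] theorem modelData₁_σ : (S.modelData₁ sg hsg am l δ ham hl hδ hδ8 hl_le hδ_room hδ_up hδ_clean).σ = S.σM := rfl

/-- The window of the model. [folklore] -/
theorem modelData₁_αβ : (S.modelData₁ sg hsg am l δ ham hl hδ hδ8 hl_le hδ_room hδ_up hδ_clean).α = 2 * π * S.θ₁ - S.a / 16 ∧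
    (S.modelData₁ sg hsg am l δ ham hl hδ hδ8 hl_le hδ_room hδ_up hδ_clean).β = 2 * π * S.θ₁ + S.a / 16 := ⟨rfl, rfl⟩

/-- **The upper end knot fits the same model**: its chart image is in the model ball. [folklore] -/
theorem psi_Kn₂_mem_ball (y : 𝕊 1) : psi (S.Kn₂ y) ∈ ball (0 : 𝔼 3) (‖S.x₀‖ + 2 * S.a + 1) := by
  rw [mem_ball_zero_iff, ← circlePt_angA y, S.psi_Kn₂_circlePt]
  linarith [S.norm_Ψ_le (angA y) 2]

end

/-! ### The upper end knot as a second knot piece over the same chart -/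

section Piece

variable (sg : ℝ) (hsg : sg ^ 2 = 1) (am l δ : ℝ) (ham : 0 < am) (hl : 0 < l) (hδ : 0 < δ) (hδ8 : δ ≤ 1 / 8)
    (hl_le : 16 * l * (‖S.x₀‖ + 2 * S.a + 1) ≤ am)
    (hδ_room : δ * (16 * am * (‖S.x₀‖ + 2 * S.a + 1)) ≤ l)
    (hδ_up : δ * (16 * (‖S.x₀‖ + 2 * S.a + 1) ^ 2) < 1)
    (hδ_clean : δ * (2 * am) ≤ l * (S.a / 4))

/-- Shorthand for the model of the lower end knot. [folklore] -/
def md : ModelData := S.modelData₁ sg hsg am l δ ham hl hδ hδ8 hl_le hδ_room hδ_up hδ_clean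

/-- **The upper end knot in model coordinates** `k₂' = T ∘ chartCurve Kn₂`. [folklore] -/
def k₂' (θ : ℝ) : 𝔼 3 := (S.md sg hsg am l δ ham hl hδ hδ8 hl_le hδ_room hδ_up hδ_clean).T (S.Kn₂.chartCurve θ)

/-- On the window the upper end knot is the flat line at height `am`. [folklore] -/
theorem k₂'_flat {θ : ℝ} (hθ : θ ∈ Icc (2 * π * S.θ₁ - S.a / 16) (2 * π * S.θ₁ + S.a / 16)) :
    S.k₂' sg hsg am l δ ham hl hδ hδ8 hl_le hδ_room hδ_up hδ_clean θ =
      (S.md sg hsg am l δ ham hl hδ hδ8 hl_le hδ_room hδ_up hδ_clean).S θ • ChartData.e3 0 + am • ChartData.e3 1 := by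
  have hp : (S.md sg hsg am l δ ham hl hδ hδ8 hl_le hδ_room hδ_up hδ_clean).p = S.x₀ := rfl
  have he : (S.md sg hsg am l δ ham hl hδ hδ8 hl_le hδ_room hδ_up hδ_clean).e = S.e := rfl
  have hσ : (S.md sg hsg am l δ ham hl hδ hδ8 hl_le hδ_room hδ_up hδ_clean).σ = S.σM := rfl
  have ha : (S.md sg hsg am l δ ham hl hδ hδ8 hl_le hδ_room hδ_up hδ_clean).a = am := rfl
  rw [k₂', Knot.chartCurve_apply, S.seg₂ hθ, ModelData.T_apply, hp, add_sub_cancel_left, map_smul, ← he,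
    ModelData.M_e, ModelData.S, hσ, ModelData.x₀, ha]
  simp [smul_smul, add_comm]

/-- The upper end knot stays at heights `≥ am`. [folklore] -/
theorem am_le_k₂'_one (θ : ℝ) : am ≤ S.k₂' sg hsg am l δ ham hl hδ hδ8 hl_le hδ_room hδ_up hδ_clean θ 1 := by
  rw [k₂', ModelData.T_apply_one, Knot.chartCurve_apply]
  have h := S.lowest ((2 * π)⁻¹ * θ) 2
  have h' : psi (S.Kn₂ (circlePoint θ)) 2 = S.Ψ (D.F ((2 * π)⁻¹ * θ, 2)).1 2 := by rw [S.psi_Kn₂, D.k₂_eq]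
  have ha : (S.md sg hsg am l δ ham hl hδ hδ8 hl_le hδ_room hδ_up hδ_clean).a = am := rfl
  have hp : (S.md sg hsg am l δ ham hl hδ hδ8 hl_le hδ_room hδ_up hδ_clean).p = S.x₀ := rfl
  have hl' : (S.md sg hsg am l δ ham hl hδ hδ8 hl_le hδ_room hδ_up hδ_clean).l = l := rfl
  rw [ha, hp, hl', h']
  nlinarith

/-- **The upper end knot as a knot piece over the chart of the lower one.** [folklore] -/
def piece₂ : KnotPiece (S.md sg hsg am l δ ham hl hδ hδ8 hl_le hδ_room hδ_up hδ_clean).chart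
    (S.md sg hsg am l δ ham hl hδ hδ8 hl_le hδ_room hδ_up hδ_clean).seg' where
  k := S.k₂' sg hsg am l δ ham hl hδ hδ8 hl_le hδ_room hδ_up hδ_clean
  contDiff_k := (Knot.IsConicalConcordance.contDiff_affT _ _ _ _).comp (Knot.contDiff_chartCurve S.Kn₂_ne_southPole)
  periodic_k θ := by
    show (S.md sg hsg am l δ ham hl hδ hδ8 hl_le hδ_room hδ_up hδ_clean).T (S.Kn₂.chartCurve (θ + 2 * Real.pi)) =
      (S.md sg hsg am l δ ham hl hδ hδ8 hl_le hδ_room hδ_up hδ_clean).T (S.Kn₂.chartCurve θ)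
    rw [S.Kn₂.periodic_chartCurve]
  deriv_k_ne_zero θ := by
    set m := S.md sg hsg am l δ ham hl hδ hδ8 hl_le hδ_room hδ_up hδ_clean with hm
    have hd : HasDerivAt (S.k₂' sg hsg am l δ ham hl hδ hδ8 hl_le hδ_room hδ_up hδ_clean)
        ((m.l • (m.M : 𝔼 3 →L[ℝ] 𝔼 3)) (deriv S.Kn₂.chartCurve θ)) θ := by
      have h1 := ((Knot.contDiff_chartCurve S.Kn₂_ne_southPole).differentiable (by simp) θ).hasDerivAt
      exact (Knot.IsConicalConcordance.hasFDerivAt_affT m.x₀ m.p m.M m.l _).comp_hasDerivAt θ h1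
    rw [hd.deriv]
    intro h0
    have h0' : m.l • m.M (deriv S.Kn₂.chartCurve θ) = 0 := h0
    rw [smul_eq_zero] at h0'
    rcases h0' with h | h
    · exact m.l_pos.ne' h
    · exact Knot.deriv_chartCurve_ne_zero S.Kn₂_ne_southPole θ (m.M.injective (by rw [h, map_zero]))
  k_inj s' t hst := by
    have h1 : S.Kn₂.chartCurve s' = S.Kn₂.chartCurve t :=
      (S.md sg hsg am l δ ham hl hδ hδ8 hl_le hδ_room hδ_up hδ_clean).injective_T hst
    exact ModelData.exists_of_circlePoint_eq ((Knot.chartCurve_eq_iff S.Kn₂_ne_southPole).1 h1)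
  flat θ hθ := S.k₂'_flat sg hsg am l δ ham hl hδ hδ8 hl_le hδ_room hδ_up hδ_clean hθ
  above θ := S.am_le_k₂'_one sg hsg am l δ ham hl hδ hδ8 hl_le hδ_room hδ_up hδ_clean θ

/-- The curve of the second piece, recalled. [folklore] -/
@[simp] theorem piece₂_k : (S.piece₂ sg hsg am l δ ham hl hδ hδ8 hl_le hδ_room hδ_up hδ_clean).k =
    S.k₂' sg hsg am l δ ham hl hδ hδ8 hl_le hδ_room hδ_up hδ_clean := rfl

/-- Coordinates of the second piece: `|k 0| ≤ 2 l ρ'`, `k 1 ≤ am + 2 l ρ'`, `|k 2| ≤ 2 l ρ'`. [folklore] -/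
theorem k₂'_bounds (θ : ℝ) :
    |S.k₂' sg hsg am l δ ham hl hδ hδ8 hl_le hδ_room hδ_up hδ_clean θ 0| ≤ 2 * l * (‖S.x₀‖ + 2 * S.a + 1) ∧
    S.k₂' sg hsg am l δ ham hl hδ hδ8 hl_le hδ_room hδ_up hδ_clean θ 1 ≤ am + 2 * l * (‖S.x₀‖ + 2 * S.a + 1) ∧
    |S.k₂' sg hsg am l δ ham hl hδ hδ8 hl_le hδ_room hδ_up hδ_clean θ 2| ≤ 2 * l * (‖S.x₀‖ + 2 * S.a + 1) := by
  have hb : ‖psi (S.Kn₂ (circlePoint θ)) - (S.md sg hsg am l δ ham hl hδ hδ8 hl_le hδ_room hδ_up hδ_clean).p‖ ≤ 2 * (‖S.x₀‖ + 2 * S.a + 1) := by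
    have h1 : ‖psi (S.Kn₂ (circlePoint θ))‖ ≤ ‖S.x₀‖ + 2 * S.a := by
      rw [← circlePt_angA (circlePoint θ), S.psi_Kn₂_circlePt]; exact S.norm_Ψ_le _ _
    have hp : (S.md sg hsg am l δ ham hl hδ hδ8 hl_le hδ_room hδ_up hδ_clean).p = S.x₀ := rfl
    rw [hp]
    calc ‖psi (S.Kn₂ (circlePoint θ)) - S.x₀‖ ≤ ‖psi (S.Kn₂ (circlePoint θ))‖ + ‖S.x₀‖ := norm_sub_le _ _
      _ ≤ 2 * (‖S.x₀‖ + 2 * S.a + 1) := by linarith [S.a_pos]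
  have hl' : (S.md sg hsg am l δ ham hl hδ hδ8 hl_le hδ_room hδ_up hδ_clean).l = l := rfl
  have ha : (S.md sg hsg am l δ ham hl hδ hδ8 hl_le hδ_room hδ_up hδ_clean).a = am := rfl
  have h0 := (S.md sg hsg am l δ ham hl hδ hδ8 hl_le hδ_room hδ_up hδ_clean).abs_M_apply_le (psi (S.Kn₂ (circlePoint θ)) - (S.md sg hsg am l δ ham hl hδ hδ8 hl_le hδ_room hδ_up hδ_clean).p) 0
  have h1 := (S.md sg hsg am l δ ham hl hδ hδ8 hl_le hδ_room hδ_up hδ_clean).abs_M_apply_le (psi (S.Kn₂ (circlePoint θ)) - (S.md sg hsg am l δ ham hl hδ hδ8 hl_le hδ_room hδ_up hδ_clean).p) 1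
  have h2 := (S.md sg hsg am l δ ham hl hδ hδ8 hl_le hδ_room hδ_up hδ_clean).abs_M_apply_le (psi (S.Kn₂ (circlePoint θ)) - (S.md sg hsg am l δ ham hl hδ hδ8 hl_le hδ_room hδ_up hδ_clean).p) 2
  refine ⟨?_, ?_, ?_⟩
  · rw [k₂', Knot.chartCurve_apply, ModelData.T_apply_coord, hl']
    simp only [Fin.zero_eq_one_iff, OfNat.ofNat_ne_one, if_false, zero_add]
    rw [abs_mul, abs_of_pos hl]; nlinarith
  · rw [k₂', Knot.chartCurve_apply, ModelData.T_apply_coord, hl', ha]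
    simp only [if_true]
    nlinarith [le_abs_self ((S.md sg hsg am l δ ham hl hδ hδ8 hl_le hδ_room hδ_up hδ_clean).M (psi (S.Kn₂ (circlePoint θ)) - (S.md sg hsg am l δ ham hl hδ hδ8 hl_le hδ_room hδ_up hδ_clean).p) 1)]
  · rw [k₂', Knot.chartCurve_apply, ModelData.T_apply_coord, hl']
    simp only [show (2 : Fin 3) ≠ 1 by decide, if_false, zero_add]
    rw [abs_mul, abs_of_pos hl]; nlinarith

/-- **The second piece fits in the tube** under the same conditions as the first. [folklore] -/
theorem tubeFit₂ {η' ε : ℝ} (hη : η' ≤ 1) (hℓη : l * S.ℓ ≤ η' / 8) (hρη : 8 * l * (‖S.x₀‖ + 2 * S.a + 1) ≤ η')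
    (haε : 2 * am < ε) : (S.piece₂ sg hsg am l δ ham hl hδ hδ8 hl_le hδ_room hδ_up hδ_clean).TubeFit η' ε where
  η_le := hη
  lo := by
    rw [ModelData.chart_θlo, ModelData.θlo]
    show -(η' / 8) ≤ -(l * S.ℓ) / 4
    have := mul_pos hl S.ℓ_pos; linarith
  hi := by
    rw [ModelData.chart_θhi, ModelData.θhi]
    show l * S.ℓ / 4 ≤ η' / 8
    have := mul_pos hl S.ℓ_pos; linarith
  kθ θ := by
    obtain ⟨h0, -, -⟩ := S.k₂'_bounds sg hsg am l δ ham hl hδ hδ8 hl_le hδ_room hδ_up hδ_clean θ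
    rw [abs_le] at h0
    rw [piece₂_k]; exact ⟨by linarith [h0.1], by linarith [h0.2]⟩
  kd θ := by
    obtain ⟨-, h1, h2⟩ := S.k₂'_bounds sg hsg am l δ ham hl hδ hδ8 hl_le hδ_room hδ_up hδ_clean θ
    have ha' := S.am_le_k₂'_one sg hsg am l δ ham hl hδ hδ8 hl_le hδ_room hδ_up hδ_clean θ
    rw [abs_le] at h2
    rw [piece₂_k, mem_ball_zero_iff, Prod.norm_mk, Real.norm_eq_abs, Real.norm_eq_abs, max_lt_iff, abs_lt, abs_lt]
    have : 2 * l * (‖S.x₀‖ + 2 * S.a + 1) ≤ am / 8 := by linarith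
    exact ⟨⟨by linarith, by linarith⟩, ⟨by linarith, by linarith⟩⟩
  two_a_lt := haε

/-- **The second piece is clean near the band.** [folklore] -/
theorem clean₂ (θ : ℝ)
    (h0 : (S.piece₂ sg hsg am l δ ham hl hδ hδ8 hl_le hδ_room hδ_up hδ_clean).k θ 0 ∈
      Ioo ((S.md sg hsg am l δ ham hl hδ hδ8 hl_le hδ_room hδ_up hδ_clean).chart.θlo -
            (S.md sg hsg am l δ ham hl hδ hδ8 hl_le hδ_room hδ_up hδ_clean).chart.wid)
          ((S.md sg hsg am l δ ham hl hδ hδ8 hl_le hδ_room hδ_up hδ_clean).chart.θhi +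
            (S.md sg hsg am l δ ham hl hδ hδ8 hl_le hδ_room hδ_up hδ_clean).chart.wid))
    (h1 : (S.piece₂ sg hsg am l δ ham hl hδ hδ8 hl_le hδ_room hδ_up hδ_clean).k θ 1 <
      (S.md sg hsg am l δ ham hl hδ hδ8 hl_le hδ_room hδ_up hδ_clean).chart.a +
        2 * (S.md sg hsg am l δ ham hl hδ hδ8 hl_le hδ_room hδ_up hδ_clean).chart.a *
          (S.md sg hsg am l δ ham hl hδ hδ8 hl_le hδ_room hδ_up hδ_clean).chart.δ) :
    ∃ θ' ∈ Icc (S.md sg hsg am l δ ham hl hδ hδ8 hl_le hδ_room hδ_up hδ_clean).seg'.α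
        (S.md sg hsg am l δ ham hl hδ hδ8 hl_le hδ_room hδ_up hδ_clean).seg'.β,
      ∃ n : ℤ, θ = θ' + n * (2 * Real.pi) := by
  set m := S.md sg hsg am l δ ham hl hδ hδ8 hl_le hδ_room hδ_up hδ_clean with hm
  rw [ModelData.chart_wid, ModelData.chart_θlo, ModelData.chart_θhi, ModelData.θlo, ModelData.θhi, piece₂_k, k₂',
    Knot.chartCurve_apply, ModelData.T_apply_zero] at h0
  rw [ModelData.chart_a, ModelData.chart_δ, piece₂_k, k₂', Knot.chartCurve_apply, ModelData.T_apply_one] at h1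
  rw [ModelData.seg'_α, ModelData.seg'_β]
  have hp : m.p = S.x₀ := rfl
  have he : m.e = S.e := rfl
  have hℓ : m.ℓ = S.ℓ := rfl
  have hl' : m.l = l := rfl
  have ha : m.a = am := rfl
  have hδ' : m.δ = δ := rfl
  have hα : m.α = 2 * π * S.θ₁ - S.a / 16 := rfl
  have hβ : m.β = 2 * π * S.θ₁ + S.a / 16 := rfl
  rw [hp, he, hℓ, hl'] at h0
  rw [hp, hl', ha, hδ'] at h1
  rw [hα, hβ]
  set z := psi (S.Kn₂ (circlePoint θ)) with hz
  -- the box conditions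
  have hb1 : |⟪z - S.x₀, S.e⟫| < S.ℓ := by
    rw [abs_lt]; constructor <;> nlinarith [h0.1, h0.2]
  have hb2 : z 2 < S.x₀ 2 + S.a / 4 := by nlinarith
  have hbox : ∃ w ∈ Icc (-S.ℓ) S.ℓ, z = S.x₀ + w • S.e := by
    rw [hz, ← circlePt_angA (circlePoint θ), S.psi_Kn₂_circlePt] at hb1 hb2 ⊢
    exact S.box _ _ hb1 hb2
  obtain ⟨w, hw, hzw⟩ := hbox
  -- `w = σM θ'`
  have hivt := intermediate_value_Icc (show 2 * π * S.θ₁ - S.a / 16 ≤ 2 * π * S.θ₁ + S.a / 16 by linarith [S.a_pos])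
    S.contDiff_σM.continuous.continuousOn
  rw [S.σM_ends.1, S.σM_ends.2] at hivt
  obtain ⟨θ', hθ', hθ's⟩ := hivt hw
  refine ⟨θ', hθ', ?_⟩
  have heq : S.Kn₂.chartCurve θ' = S.Kn₂.chartCurve θ := by
    rw [Knot.chartCurve_apply, Knot.chartCurve_apply, S.seg₂ hθ', hθ's, ← hzw]
  exact ModelData.exists_of_circlePoint_eq ((Knot.chartCurve_eq_iff S.Kn₂_ne_southPole).1 heq)

end Piece

end StripPicture

end Literature.Topology.FourManifolds
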